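import Summits.Parity.GeneralizedHardyLittlewood.Theorems.GeneralizedHardyLittlewoodDimOne
import Summits.Parity.GeneralizedHardyLittlewood.Theorems.DicksonFibrationDimOneCore
import Summits.Parity.GeneralizedHardyLittlewood.Theorems.LeeYangFibresPrimeCellsRelativeHardyLittlewoodTuples
import Summits.Parity.GeneralizedHardyLittlewood.Theorems.LeeYangFibresRelativeDimOne
import Summits.Parity.GeneralizedHardyLittlewood.Theses.HyperbolicConstellations
import Summits.Parity.GeneralizedHardyLittlewood.Theses.InverseSieveTuples
import HarnessLib

/-!
# Position of the named open statement `GeneralizedHardyLittlewoodDimOne` in the tree (kernel-checked certificates)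

`Theorems/GeneralizedHardyLittlewoodDimOne.lean` registers the `d = 1` case of Green–Tao's Conjecture 1.2 as the
`@[conjecture]` constant `Summit.Parity.GeneralizedHardyLittlewood.GeneralizedHardyLittlewoodDimOne` (definition item
`defn-GeneralizedHardyLittlewoodDimOne`), importing Literature only. This companion file, which may import the Theses
files and the Theorems cone, records where that constant sits — every statement below is a composition of theorems
already in the tree (line `birth` of crux stmt-Parity-0819, leads c2/c3; routes LeeYangFibres / AbsoluteUpgrade / EngineToGHL):

* IDENTITY with the route items (all `Iff.rfl` — the texts are verbatim equal):
  `dicksonFibration_dimOne_iff`, `hyperbolicConstellations_dimOne_iff`, `leeYangFibres_dimOne_iff`,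
  `inverseSieveTuples_dimOne_iff`;
* EQUIVALENCE with the sub-problem Statement (Green–Tao Conj. 1.2, all `d`, all complexities):
  `generalizedHardyLittlewood_iff_generalizedHardyLittlewoodDimOne` — `→` is `d := 1`, `←` is the PROVED fibration
  lemma `Theses.DicksonFibration.Assembly_holds = Theorems.leeYangFibres_fibrationLemma` (GT 2010 §1, arXiv p. 5);
* EQUIVALENCE with the registered open core of line `birth`:
  `twoFlatFactorsCore_iff_generalizedHardyLittlewoodDimOne` — the admissible (`β_p > 0` at every prime), `t ≥ 2`,
  rough-vs-rough form `|Σ_{#T ≥ 2} corrTerm T| ≤ εN` (`Cruxes.DimOne.BirthSieve.core_iff_dimOne`, p161963);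
* what is PROVED of it (cited by name, section "The proved part"): the `t = 1` slice (`BirthSieve.dimOne_one`, PNT in
  progressions mod `a ≤ L` uniformly in shifts `≤ LN`) and every locally obstructed system
  (`BirthSieve.dimOne_of_localFactor_eq_zero`);
* HARDNESS: it implies the registered open conjectures `Literature.NumberTheory.Sieve.HardyLittlewoodTuples`
  (parity.S01; `hardyLittlewoodTuples_of_generalizedHardyLittlewoodDimOne`, through
  `Cruxes.PrimeCellsRelative.Sketch.dimOne_implies_hardyLittlewoodTuples`) and `TwinPrimeConjecture`
  (`twinPrimeConjecture_of_generalizedHardyLittlewoodDimOne`, through `relativeDimOne_of_dimOne` and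
  `twinPrimeConjecture_of_relativeDimOne`), and it is Landau–Siegel-hard: modulo the vendored theorem of
  Matomäki–Merikoski (Thm. 1.3), Siegel zeros of unbounded quality refute it
  (`not_generalizedHardyLittlewoodDimOne_of_unboundedSiegelZeros`, through `BirthSieve.core_false_of_unboundedSiegelZeros`).

Nothing here is new mathematics; the point is that the ONE citable name now carries, by `exact`, everything the tree
knows about the common open target of the `d = 1` routes. References: B. Green, T. Tao, Ann. of Math. 171 (2010),
Conj. 1.2 [GreenTao2010]; G. H. Hardy, J. E. Littlewood, Acta Math. 44 (1923) [HardyLittlewood1923];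
K. Matomäki, J. Merikoski, IMRN (2023), Thm. 1.3 [MatomakiMerikoski2023].
-/

noncomputable section

namespace Summit.Parity.GeneralizedHardyLittlewood

open Literature.NumberTheory.Sieve
open Summit.Parity.GeneralizedHardyLittlewood.Cruxes.DimOne.BirthSieve (TwoFlatFactorsCore core_iff_dimOne
  core_false_of_unboundedSiegelZeros)

/-! ## Identity with the route items (verbatim texts) -/

/-- Route `DicksonFibration`, item stmt-Parity-0819: `DimOne` IS the named conjecture. [cite: GreenTao2010, Conj. 1.2] -/
theorem dicksonFibration_dimOne_iff :
    Theses.DicksonFibration.DimOne ↔ GeneralizedHardyLittlewoodDimOne := Iff.rfl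

/-- Route `HyperbolicConstellations`: its target `DimOne` IS the named conjecture. [cite: GreenTao2010, Conj. 1.2] -/
theorem hyperbolicConstellations_dimOne_iff :
    Theses.HyperbolicConstellations.DimOne ↔ GeneralizedHardyLittlewoodDimOne := Iff.rfl

/-- Route `LeeYangFibres`: its target `DimOne` IS the named conjecture. [cite: GreenTao2010, Conj. 1.2] -/
theorem leeYangFibres_dimOne_iff :
    Theses.LeeYangFibres.DimOne ↔ GeneralizedHardyLittlewoodDimOne := Iff.rfl

/-- Route `InverseSieveTuples`: its target `DimOne` IS the named conjecture. [cite: GreenTao2010, Conj. 1.2] -/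
theorem inverseSieveTuples_dimOne_iff :
    Theses.InverseSieveTuples.DimOne ↔ GeneralizedHardyLittlewoodDimOne := Iff.rfl

/-! ## Equivalence with the sub-problem and with the open core -/

/-- **Green–Tao's Conjecture 1.2 (all dimensions, all complexities) is EQUIVALENT to its one-variable case**:
`→` is the specialisation `d := 1`; `←` is the fibration lemma ("holding `d − 1` of the variables fixed and summing
in the remaining one", GT 2010 §1), proved in the tree as `Theses.DicksonFibration.Assembly_holds`.
[cite: GreenTao2010, Conj. 1.2 and §1] -/
theorem generalizedHardyLittlewood_iff_generalizedHardyLittlewoodDimOne :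
    _root_.GeneralizedHardyLittlewood ↔ GeneralizedHardyLittlewoodDimOne :=
  ⟨generalizedHardyLittlewoodDimOne_of_generalizedHardyLittlewood,
    fun h => Theses.DicksonFibration.Assembly_holds (dicksonFibration_dimOne_iff.mpr h)⟩

/-- **The named conjecture is EQUIVALENT to the registered open core of line `birth`** (`TwoFlatFactorsCore`:
`t ≥ 2`, `β_p(Ψ) > 0` at every prime, `|Σ_{T ⊆ [t], #T ≥ 2} corrTerm T Ψ K N| ≤ εN` uniformly — the admissible
Dickson–Hardy–Littlewood `t`-tuple conjecture in rough-vs-rough form). [cite: GreenTao2010, Conj. 1.2 and §12 (12.3)] -/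
theorem twoFlatFactorsCore_iff_generalizedHardyLittlewoodDimOne :
    TwoFlatFactorsCore ↔ GeneralizedHardyLittlewoodDimOne :=
  core_iff_dimOne.trans dicksonFibration_dimOne_iff

/-! ## The proved part (by name, not restated)

The `t = 1` slice of the named conjecture is the tree theorem `Cruxes.DimOne.BirthSieve.dimOne_one` (PNT in
progressions modulo `a ≤ L`, uniform over shifts `|b| ≤ LN` and convex `K ⊆ [−N, N]`; two-sided Fundamental Lemma +
Bombieri–Vinogradov through the sieve model of line `birth`), and every LOCALLY OBSTRUCTED system (`β_p(Ψ) = 0` at some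
prime: `(n, n+1)`, `(n, n+2, n+4)`, non-primitive forms; then `𝔖(Ψ) = 0` and `Σ_K Πᵢ Λ(ψᵢ n) = O_{t,L}(log^{t+1} N)`)
satisfies it by `Cruxes.DimOne.BirthSieve.dimOne_of_localFactor_eq_zero` — both in
`Theorems/DicksonFibrationDimOnePerimeter.lean`; their statements are literally the corresponding slices of
`GeneralizedHardyLittlewoodDimOne`, so they are cited here rather than re-exported (dedup). What remains open is exactly
`TwoFlatFactorsCore` (previous section). -/

/-! ## Hardness certificates -/

/-- **The named conjecture implies the Hardy–Littlewood prime `k`-tuples conjecture** (the tree's registered open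
statement parity.S01, `Literature.NumberTheory.Sieve.HardyLittlewoodTuples`: `π_H(x) ∼ 𝔖(H) x / log^k x` for every
admissible `H`), through `Cruxes.PrimeCellsRelative.Sketch.dimOne_implies_hardyLittlewoodTuples`.
[cite: HardyLittlewoodPN3, Theorem X 1 p. 61] -/
theorem hardyLittlewoodTuples_of_generalizedHardyLittlewoodDimOne (h : GeneralizedHardyLittlewoodDimOne) :
    HardyLittlewoodTuples :=
  Cruxes.PrimeCellsRelative.Sketch.dimOne_implies_hardyLittlewoodTuples (leeYangFibres_dimOne_iff.mpr h)

/-- **The named conjecture implies the twin prime conjecture** (`Literature.NumberTheory.Sieve.TwinPrimeConjecture`),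
through `relativeDimOne_of_dimOne` and `twinPrimeConjecture_of_relativeDimOne` (route LeeYangFibres).
[cite: HardyLittlewood1923, Conjecture B] -/
theorem twinPrimeConjecture_of_generalizedHardyLittlewoodDimOne (h : GeneralizedHardyLittlewoodDimOne) :
    TwinPrimeConjecture :=
  Theorems.LeeYangFibresRelativeDimOne.twinPrimeConjecture_of_relativeDimOne
    (Theorems.LeeYangFibresRelativeDimOne.relativeDimOne_of_dimOne (leeYangFibres_dimOne_iff.mpr h))

/-- **The named conjecture is Landau–Siegel-hard**: modulo the vendored theorem of Matomäki–Merikoski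
(`Literature.Barriers.Parity.MatomakiMerikoski2023_pairCorrelation`, Thm. 1.3), Siegel zeros of unbounded quality
(`Literature.Barriers.Parity.UnboundedSiegelZeros`) refute it — the shift-uniform pair family `(n, n + 2q)`,
`N = q^{10}`, `L = 3` (through `BirthSieve.core_false_of_unboundedSiegelZeros`). So any proof of it is, in
particular, a proof that Siegel zeros have bounded quality. [cite: MatomakiMerikoski2023, Theorem 1.3] -/
theorem not_generalizedHardyLittlewoodDimOne_of_unboundedSiegelZeros
    (hMM : Literature.Barriers.Parity.MatomakiMerikoski2023_pairCorrelation)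
    (hU : Literature.Barriers.Parity.UnboundedSiegelZeros) : ¬ GeneralizedHardyLittlewoodDimOne :=
  fun h => core_false_of_unboundedSiegelZeros hMM hU
    (twoFlatFactorsCore_iff_generalizedHardyLittlewoodDimOne.mpr h)

end Summit.Parity.GeneralizedHardyLittlewood

end
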